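import Summits.BirchSwinnertonDyer.BirchSwinnertonDyer.Theorems.ManinLocalTwoThreeShimuraKernelRealStructure
import HarnessLib

/-!
# THE REAL TRACE DECIDES `Λ₁(f)` AT ODD SHIMURA INDEX, AND IS BLIND AT EXPONENT TWO:
# `2 ∤ [Λ₀:Λ₁] ⟹ Λ₁(f) = {z ∈ Λ₀(f) : z + z̄ ∈ Λ₁(f)}`, `Λ₀(f)⁻ ⊆ Λ₁(f)`;  `2Λ₀ ⊆ Λ₁ ⟹ z + z̄ ∈ Λ₁(f)` for every `z ∈ Λ₀(f)`

Summit `BirchSwinnertonDyer`, route `ManinLocalTwoThree` (cell bsd-f2-manin), cruxes C2 `ManinOddAtFour` (stmt-BirchSwinnertonDyer-22967) and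
C3 `ManinPrimeToThreeAtNine` (stmt-BirchSwinnertonDyer-22968): the statements are level-uniform.  Planner seat bsd-f2-manin-es (LENS es: the Shimura
covering `X₁(N) → X₀(N)` read on period lattices), gen 47; TURNKEY T-es-118 for the C2/C3 LEAD.  In-tree imports only; independent of T-es-112…117.

THE MECHANISM (one line).  For a cusp form `f` with real Fourier coefficients complex conjugation acts TRIVIALLY on the Shimura quotient
`Λ₀(f)/Λ₁(f)` (`conj_sub_self_mem_periodLatticeGamma1`, p2 g9: `z̄ − z ∈ Λ₁(f)` for `z ∈ Λ₀(f)`), hence **`z + z̄ ≡ 2z (mod Λ₁(f))`**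
(§1 `add_conj_mem_periodLatticeGamma1_iff_two_mul_mem`).  Everything below is this congruence read at the prime `2`.

§2 ODD SHIMURA INDEX (`ShimuraIndexPrimeTo 2 f`: `Λ₀/Λ₁` has no element of order `2`).  Then `2z ∈ Λ₁ ⟺ z ∈ Λ₁`, so
* `mem_periodLatticeGamma1_iff_add_conj_mem` — **`z ∈ Λ₁(f) ⟺ z + z̄ ∈ Λ₁(f)`** for `z ∈ Λ₀(f)`: membership in the `Γ₁(N)`-lattice is decided by
  the REAL TRACE alone;
* `mem_periodLatticeGamma1_of_conj_eq_neg` — **`Λ₀(f)⁻ ⊆ Λ₁(f)`**: every anti-real `Γ₀(N)`-period (`z̄ = −z`) is a `Γ₁(N)`-period (dually: the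
  Shimura kernel `E₀ ∩ Σ(N)` of odd order pairs trivially with the anti-real periods — the level-uniform form of p1 g14's `(−1)`-eigenline
  `conj_add_self_mem_three_mul_of_mem_periodLatticeGamma1` at `9 ∣ N`, index `3`);
* `exists_add_conj_notMem_periodLatticeGamma1` — if moreover `Λ₁(f) ≠ Λ₀(f)` then SOME real trace `z + z̄`, `z ∈ Λ₀(f)`, is NOT a `Γ₁(N)`-period:
  at odd index the real direction carries the whole index (§4 transports this to the Néron lattice of a lattice-optimal `X₀(N)`-datum:
  `exists_real_mem_lattice_notMem` — a REAL Néron period of `E₀` outside `c₀Λ₁(f)`).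
§3 EXPONENT TWO (`2Λ₀(f) ⊆ Λ₁(f)`, e.g. index `2`).  Then EVERY real trace is a `Γ₁(N)`-period (`add_conj_mem_periodLatticeGamma1_of_two_mul_mem`),
and contrapositively a real trace outside `Λ₁(f)` forces `2Λ₀ ⊄ Λ₁` (`exists_two_mul_notMem_of_exists_add_conj_notMem`).

CENSUS SHADOW (es g47, `HOME/es/g47/type2census.out`, sha16 d0eec243b4bbb707; Cremona `allbsd`/`allisog`, the 86 classes `N ≤ 9999` of the cell's
Stevens table imc g29 j339713 with `E₁ ≠ E₀`, real periods compared as `Ω⁺(E₁) = r⁺·Ω⁺(E₀)`): odd index `k ∈ {3,5}` — `r⁺ = k` in 22/22 (§2: the real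
direction carries the index); index `2` with `Λ_{E₀}` non-rectangular (`Δ(E₀) < 0`, traces `= Λ_{E₀} ∩ ℝ`) — `r⁺ = 1` in 42/42 (§3: `Ω⁺(E₀) ∈ Λ_{E₁}`);
index `2` with `Λ_{E₀}` rectangular (traces `= 2(Λ_{E₀} ∩ ℝ)`, §3 silent) — `r⁺ = 1 : 2 : ½·(row doubling)` splits 11 : 3 : 6; 0 anomalies.

HONEST FRAMING.  Linear algebra of an involution on a rank-`2` lattice over Stevens 1989 §2 / Manin 1972 §1.6; printed-level mathematics, new formal
statements in the `ShimuraIndexPrimeTo` currency of the route.  No definitions, no sorry, no fact binders, no kernel-external computation.  C2, C3,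
Manin's conjecture and BSD are NOT proved by this file.
[cite: Stevens1989, §2] [cite: Manin1972, §1.6] [cite: LingOesterle1991, §1] [cite: Cremona1997, §2.8 and §2.10]
-/

set_option autoImplicit false
-- the summit-side namespace `Summit.BirchSwinnertonDyer.BirchSwinnertonDyer.…` is the tree's (summit = sub-problem)
set_option linter.dupNamespace false

noncomputable section

open scoped Classical ComplexConjugate

open CongruenceSubgroup WeierstrassCurve
open Literature.NumberTheory.EllipticCurves Literature.NumberTheory.EllipticCurves.ModularForms
open Summit.BirchSwinnertonDyer.Rank1Residual.ManinAdditive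
open Summit.BirchSwinnertonDyer.Rank1Residual.ManinAdditive.KatoCurve

namespace Summit.BirchSwinnertonDyer.BirchSwinnertonDyer.Theorems.ManinLocalTwoThree.RealTrace

section Lattice

variable {N : ℕ} [NeZero N] {f : CuspForm (Gamma0 N) 2}

/-! ## §1 Traces versus doubles: `z + z̄ ≡ 2z (mod Λ₁(f))` -/

/-- **`z + z̄ ∈ Λ₁(f) ⟺ 2z ∈ Λ₁(f)`** for `z ∈ Λ₀(f)` and `f` with real coefficients: the two differ by `z̄ − z ∈ Λ₁(f)`. [cite: Stevens1989, §2] -/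
theorem add_conj_mem_periodLatticeGamma1_iff_two_mul_mem (h : ∀ n, (cuspCoeff f n).im = 0) {z : ℂ}
    (hz : z ∈ periodLattice f) : z + conj z ∈ periodLatticeGamma1 f ↔ 2 * z ∈ periodLatticeGamma1 f := by
  have h1 := conj_sub_self_mem_periodLatticeGamma1 h hz
  constructor
  · intro ht
    have e : (2 : ℂ) * z = (z + conj z) - (conj z - z) := by ring
    rw [e]; exact sub_mem ht h1
  · intro h2
    have e : z + conj z = 2 * z + (conj z - z) := by ring
    rw [e]; exact add_mem h2 h1

/-- An anti-real `Γ₀(N)`-period has its double in `Λ₁(f)`: `z̄ = −z ⟹ 2z = −(z̄ − z) ∈ Λ₁(f)`. [cite: Stevens1989, §2] -/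
theorem two_mul_mem_periodLatticeGamma1_of_conj_eq_neg (h : ∀ n, (cuspCoeff f n).im = 0) {z : ℂ}
    (hz : z ∈ periodLattice f) (hc : conj z = -z) : 2 * z ∈ periodLatticeGamma1 f := by
  have h1 := conj_sub_self_mem_periodLatticeGamma1 h hz
  have e : (2 : ℂ) * z = -(conj z - z) := by rw [hc]; ring
  rw [e]; exact neg_mem h1

/-- A real trace of a `Γ₀(N)`-period is a `Γ₀(N)`-period fixed by conjugation. [folklore] -/
theorem add_conj_mem_periodLattice (h : ∀ n, (cuspCoeff f n).im = 0) {z : ℂ} (hz : z ∈ periodLattice f) :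
    z + conj z ∈ periodLattice f ∧ conj (z + conj z) = z + conj z :=
  ⟨add_mem hz (conj_mem_periodLattice_of_real h hz), by rw [map_add, Complex.conj_conj, add_comm]⟩

/-! ## §2 Odd Shimura index: the real trace decides `Λ₁(f)`, and `Λ₀(f)⁻ ⊆ Λ₁(f)` -/

/-- **`z ∈ Λ₁(f) ⟺ z + z̄ ∈ Λ₁(f)`** (`z ∈ Λ₀(f)`) when `Λ₀(f)/Λ₁(f)` has no `2`-torsion: `z + z̄ ≡ 2z` and `2z ∈ Λ₁ ⟹ z ∈ Λ₁`.
[cite: Stevens1989, §2] -/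
theorem mem_periodLatticeGamma1_iff_add_conj_mem (h : ∀ n, (cuspCoeff f n).im = 0) (hS : ShimuraIndexPrimeTo 2 f)
    {z : ℂ} (hz : z ∈ periodLattice f) : z ∈ periodLatticeGamma1 f ↔ z + conj z ∈ periodLatticeGamma1 f := by
  rw [add_conj_mem_periodLatticeGamma1_iff_two_mul_mem h hz]
  constructor
  · intro hz1; simpa [two_mul] using add_mem hz1 hz1
  · intro h2; exact hS z hz (by exact_mod_cast h2)

/-- **`Λ₀(f)⁻ ⊆ Λ₁(f)` at odd Shimura index**: an anti-real `Γ₀(N)`-period (`z̄ = −z`) is a `Γ₁(N)`-period. [cite: Stevens1989, §2] -/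
theorem mem_periodLatticeGamma1_of_conj_eq_neg (h : ∀ n, (cuspCoeff f n).im = 0) (hS : ShimuraIndexPrimeTo 2 f)
    {z : ℂ} (hz : z ∈ periodLattice f) (hc : conj z = -z) : z ∈ periodLatticeGamma1 f :=
  hS z hz (by exact_mod_cast two_mul_mem_periodLatticeGamma1_of_conj_eq_neg h hz hc)

/-- At odd Shimura index with `Λ₁(f) ≠ Λ₀(f)`, **some real trace `z + z̄` (`z ∈ Λ₀(f)`) is not a `Γ₁(N)`-period**: the real direction carries
the index. [cite: Stevens1989, §2] -/
theorem exists_add_conj_notMem_periodLatticeGamma1 (h : ∀ n, (cuspCoeff f n).im = 0) (hS : ShimuraIndexPrimeTo 2 f)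
    (hne : periodLatticeGamma1 f ≠ periodLattice f) : ∃ z ∈ periodLattice f, z + conj z ∉ periodLatticeGamma1 f := by
  by_contra hall
  push Not at hall
  exact hne (le_antisymm (periodLatticeGamma1_le_periodLattice f)
    fun z hz ↦ (mem_periodLatticeGamma1_iff_add_conj_mem h hS hz).mpr (hall z hz))

/-- Equivalently: at odd Shimura index with `Λ₁(f) ≠ Λ₀(f)` there is a conjugation-FIXED `Γ₀(N)`-period outside `Λ₁(f)` (`Λ₀(f) ∩ ℝ ⊄ Λ₁(f)`).
[cite: Stevens1989, §2] -/
theorem exists_conj_eq_self_notMem_periodLatticeGamma1 (h : ∀ n, (cuspCoeff f n).im = 0) (hS : ShimuraIndexPrimeTo 2 f)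
    (hne : periodLatticeGamma1 f ≠ periodLattice f) : ∃ t ∈ periodLattice f, conj t = t ∧ t ∉ periodLatticeGamma1 f := by
  obtain ⟨z, hz, hzt⟩ := exists_add_conj_notMem_periodLatticeGamma1 h hS hne
  exact ⟨z + conj z, (add_conj_mem_periodLattice h hz).1, (add_conj_mem_periodLattice h hz).2, hzt⟩

/-! ## §3 Exponent two: every real trace is a `Γ₁(N)`-period -/

/-- **`2Λ₀(f) ⊆ Λ₁(f) ⟹ z + z̄ ∈ Λ₁(f)` for every `z ∈ Λ₀(f)`**: at exponent two the real trace is blind to `Λ₀/Λ₁`. [cite: Stevens1989, §2] -/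
theorem add_conj_mem_periodLatticeGamma1_of_two_mul_mem (h : ∀ n, (cuspCoeff f n).im = 0)
    (h2 : ∀ z ∈ periodLattice f, 2 * z ∈ periodLatticeGamma1 f) {z : ℂ} (hz : z ∈ periodLattice f) :
    z + conj z ∈ periodLatticeGamma1 f :=
  (add_conj_mem_periodLatticeGamma1_iff_two_mul_mem h hz).mpr (h2 z hz)

/-- Contrapositive dichotomy: a real trace outside `Λ₁(f)` forces `2Λ₀(f) ⊄ Λ₁(f)`. [cite: Stevens1989, §2] -/
theorem exists_two_mul_notMem_of_exists_add_conj_notMem (h : ∀ n, (cuspCoeff f n).im = 0)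
    (hex : ∃ z ∈ periodLattice f, z + conj z ∉ periodLatticeGamma1 f) : ∃ z ∈ periodLattice f, 2 * z ∉ periodLatticeGamma1 f := by
  obtain ⟨z, hz, hzt⟩ := hex
  exact ⟨z, hz, fun h2 ↦ hzt ((add_conj_mem_periodLatticeGamma1_iff_two_mul_mem h hz).mpr h2)⟩

/-- At odd Shimura index the two conditions agree: `(∀ z ∈ Λ₀, z + z̄ ∈ Λ₁) ⟺ Λ₁(f) = Λ₀(f)`. [cite: Stevens1989, §2] -/
theorem forall_add_conj_mem_iff_eq (h : ∀ n, (cuspCoeff f n).im = 0) (hS : ShimuraIndexPrimeTo 2 f) :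
    (∀ z ∈ periodLattice f, z + conj z ∈ periodLatticeGamma1 f) ↔ periodLatticeGamma1 f = periodLattice f := by
  constructor
  · intro hall
    by_contra hne
    obtain ⟨z, hz, hzt⟩ := exists_add_conj_notMem_periodLatticeGamma1 h hS hne
    exact hzt (hall z hz)
  · intro heq z hz
    rw [heq]; exact (add_conj_mem_periodLattice h hz).1

end Lattice

/-! ## §4 On the Néron lattice of a lattice-optimal `X₀(N)`-datum -/

section Data

variable {W₀ : WeierstrassCurve ℚ} {N : ℕ} [NeZero N]

/-- **The real direction carries an odd Shimura index.**  For a lattice-optimal `X₀(N)`-datum (`Λ_{E₀} = c₀Λ₀(f)`) with `2 ∤ [Λ₀ : Λ₁]` and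
`Λ₁(f) ≠ Λ₀(f)` there is a REAL Néron period of `E₀` (`z̄ = z`) that is not `c₀` times a `Γ₁(N)`-period. [cite: Stevens1989, §2] -/
theorem exists_real_mem_lattice_notMem (D₀ : ModularParametrizationData W₀ N)
    (hS : ShimuraIndexPrimeTo 2 D₀.f) (hne : periodLatticeGamma1 D₀.f ≠ periodLattice D₀.f) :
    ∃ z ∈ D₀.L.lattice, conj z = z ∧ ¬ ∃ w ∈ periodLatticeGamma1 D₀.f, z = D₀.c * w := by
  have hreal : ∀ n, (cuspCoeff D₀.f n).im = 0 := D₀.isNewformOf.1.cuspCoeff_im_eq_zero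
  have hc₀ : (D₀.c : ℂ) ≠ 0 := by exact_mod_cast D₀.maninConstant_ne_zero_holds
  obtain ⟨t, ht, htc, ht1⟩ := exists_conj_eq_self_notMem_periodLatticeGamma1 hreal hS hne
  refine ⟨D₀.c * t, D₀.smul_periodLattice_le t ht, by rw [map_mul, map_intCast, htc], ?_⟩
  rintro ⟨w, hw, hwt⟩
  have : t = w := mul_left_cancel₀ hc₀ hwt
  exact ht1 (this ▸ hw)

/-- **At exponent two every real trace of a Néron period lies in `c₀Λ₁(f)`** (lattice-optimal datum, `2Λ₀(f) ⊆ Λ₁(f)`): `z + z̄ = c₀(w + w̄)` with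
`w + w̄ ∈ Λ₁(f)`. [cite: Stevens1989, §2] -/
theorem add_conj_mem_smul_periodLatticeGamma1_of_two_mul_mem (D₀ : ModularParametrizationData W₀ N)
    (h₀ : ∀ z ∈ D₀.L.lattice, ∃ w ∈ periodLattice D₀.f, z = D₀.c * w)
    (h2 : ∀ w ∈ periodLattice D₀.f, 2 * w ∈ periodLatticeGamma1 D₀.f) {z : ℂ} (hz : z ∈ D₀.L.lattice) :
    ∃ y ∈ periodLatticeGamma1 D₀.f, z + conj z = D₀.c * y := by
  have hreal : ∀ n, (cuspCoeff D₀.f n).im = 0 := D₀.isNewformOf.1.cuspCoeff_im_eq_zero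
  obtain ⟨w, hw, rfl⟩ := h₀ z hz
  exact ⟨w + conj w, add_conj_mem_periodLatticeGamma1_of_two_mul_mem hreal h2 hw, by rw [map_mul, map_intCast]; ring⟩

/-- **At odd Shimura index a Néron period in `c₀Λ₀(f)` with real trace in `c₀Λ₁(f)` is itself in `c₀Λ₁(f)`** (lattice-optimal datum):
the trace criterion of §2 on `Λ_{E₀}`. [cite: Stevens1989, §2] -/
theorem exists_eq_smul_of_add_conj (D₀ : ModularParametrizationData W₀ N)
    (h₀ : ∀ z ∈ D₀.L.lattice, ∃ w ∈ periodLattice D₀.f, z = D₀.c * w) (hS : ShimuraIndexPrimeTo 2 D₀.f)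
    {z : ℂ} (hz : z ∈ D₀.L.lattice) (ht : ∃ y ∈ periodLatticeGamma1 D₀.f, z + conj z = D₀.c * y) :
    ∃ w ∈ periodLatticeGamma1 D₀.f, z = D₀.c * w := by
  have hreal : ∀ n, (cuspCoeff D₀.f n).im = 0 := D₀.isNewformOf.1.cuspCoeff_im_eq_zero
  have hc₀ : (D₀.c : ℂ) ≠ 0 := by exact_mod_cast D₀.maninConstant_ne_zero_holds
  obtain ⟨w, hw, rfl⟩ := h₀ z hz
  obtain ⟨y, hy, hyw⟩ := ht
  refine ⟨w, (mem_periodLatticeGamma1_iff_add_conj_mem hreal hS hw).mpr ?_, rfl⟩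
  have e : (D₀.c : ℂ) * (w + conj w) = D₀.c * y := by
    rw [← hyw, map_mul, map_intCast]; ring
  rw [mul_left_cancel₀ hc₀ e]; exact hy

end Data

end Summit.BirchSwinnertonDyer.BirchSwinnertonDyer.Theorems.ManinLocalTwoThree.RealTrace

end
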